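import Mathlib
import HarnessLib
import Literature.AlgebraicGeometry.Ramification.InertiaNormalSylow

/-!
# Kollár–Szabó going down, `Spec` of an action given as a homomorphism `τ : G →* (R ≃+* R)`
# (crux `WildQuotients.WildQuotientResolution`, stub `stub_phaseZeroHighDim`)

Crux stmt-ResolutionOfSingularities-15640 (`WildQuotientResolution`), registered stub `stub_phaseZeroHighDim`; programme:
`KollarSzaboGoingDown_holds` via ✓`kollarSzaboGoingDown_of_localStepLE`. The ring-level actions produced along the way
are HOMOMORPHISMS `τ : G →* (R ≃+* R)` (✓`EigenlineChart.exists_restrict_ringAut` for the quadratic transform `R₁`,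
✓`KSGoingDown.exists_quotient_ringAut` for `R₁ ⧸ (t)`, ✓`exists_stalkAction` for `𝒪_{X,x}`), not `MulSemiringAction`
instances; this file gives the `Spec` side directly in that form (convention `ρ g = Spec (τ g⁻¹)`, as in
✓`AffineQuotient.exists_specAction`):

* `exists_specAction_of_hom` — `ρ : G →* Aut (Spec R)` with `ρ g = Spec (τ g⁻¹)`;
* `specMap_comm_of_hom_equivariant` — a ring map intertwining `τA`, `τB` gives equivariant `Spec` maps;
* `mem_inertiaSubgroup_specMap_of_hom_invariant` — a `τ g`-invariant ring map `φ : R → K` to a field puts `g` in the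
  inertia group of the point `ker φ`; `mem_inertiaSubgroup_closedPoint_of_hom_residueTrivial` — residue-trivial `τ` on a
  local ring ⇒ every `g` is inert at the closed point.

[OURS · crux stmt-ResolutionOfSingularities-15640 · helper toward `stub_phaseZeroHighDim` ((K2)-scheme packaging; NOT a proof
of the stub); counted 0; AI-level work, weaker than expert review.] [folklore]
-/

-- single-problem summit: the doubled namespace component `ResolutionOfSingularities` is forced
set_option linter.dupNamespace false

noncomputable section

open CategoryTheory AlgebraicGeometry IsLocalRing
open Literature.AlgebraicGeometry.Ramification

namespace Summit.ResolutionOfSingularities.ResolutionOfSingularities.Theorems.WildQuotientResolution.KSGoingDown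

universe u v

variable {G : Type v} [Group G]

/-- **The action `g ↦ Spec (τ g⁻¹)` on `Spec R`** from a homomorphism `τ : G →* (R ≃+* R)`. [folklore] -/
theorem exists_specAction_of_hom {R : Type u} [CommRing R] (τ : G →* (R ≃+* R)) :
    ∃ ρ : G →* Aut (Spec (CommRingCat.of R)), ∀ g : G, (ρ g).hom =
      Spec.map (CommRingCat.ofHom ((τ g⁻¹ : R ≃+* R) : R →+* R)) := by
  refine ⟨MonoidHom.mk' (fun g => Scheme.Spec.mapIso (τ g⁻¹).toCommRingCatIso.op) (fun g h => ?_),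
    fun g => rfl⟩
  apply Iso.ext
  change Spec.map (CommRingCat.ofHom ((τ (g * h)⁻¹ : R ≃+* R) : R →+* R)) =
    Spec.map (CommRingCat.ofHom ((τ h⁻¹ : R ≃+* R) : R →+* R)) ≫
      Spec.map (CommRingCat.ofHom ((τ g⁻¹ : R ≃+* R) : R →+* R))
  rw [← Spec.map_comp, ← CommRingCat.ofHom_comp]
  congr 2
  refine RingHom.ext fun b => ?_
  simp only [RingHom.coe_comp, RingHom.coe_coe, Function.comp_apply, mul_inv_rev, map_mul]
  rfl

/-- **Intertwining ring maps give equivariant `Spec` maps**: if `f (τA g a) = τB g (f a)` for all `g`, `a`, then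
`ρB g ≫ Spec f = Spec f ≫ ρA g`. [folklore] -/
theorem specMap_comm_of_hom_equivariant {A B : Type u} [CommRing A] [CommRing B]
    (τA : G →* (A ≃+* A)) (τB : G →* (B ≃+* B))
    (ρA : G →* Aut (Spec (CommRingCat.of A)))
    (hρA : ∀ g, (ρA g).hom = Spec.map (CommRingCat.ofHom ((τA g⁻¹ : A ≃+* A) : A →+* A)))
    (ρB : G →* Aut (Spec (CommRingCat.of B)))
    (hρB : ∀ g, (ρB g).hom = Spec.map (CommRingCat.ofHom ((τB g⁻¹ : B ≃+* B) : B →+* B)))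
    (f : A →+* B) (hf : ∀ (g : G) (a : A), f (τA g a) = τB g (f a)) (g : G) :
    (ρB g).hom ≫ Spec.map (CommRingCat.ofHom f) = Spec.map (CommRingCat.ofHom f) ≫ (ρA g).hom := by
  rw [hρA, hρB, ← Spec.map_comp, ← Spec.map_comp, ← CommRingCat.ofHom_comp, ← CommRingCat.ofHom_comp]
  congr 2
  refine RingHom.ext fun a => ?_
  simp only [RingHom.coe_comp, RingHom.coe_coe, Function.comp_apply]
  exact (hf g⁻¹ a).symm

/-- **Inertia on `Spec B` from a `τ g`-invariant ring map to a field**: if `φ (τ g b) = φ b` for all `b`, then `g`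
lies in the inertia group of the point `ker φ` (the image of the closed point of `Spec K`). [folklore] -/
theorem mem_inertiaSubgroup_specMap_of_hom_invariant {B : Type u} [CommRing B] (τB : G →* (B ≃+* B))
    (ρB : G →* Aut (Spec (CommRingCat.of B)))
    (hρB : ∀ g, (ρB g).hom = Spec.map (CommRingCat.ofHom ((τB g⁻¹ : B ≃+* B) : B →+* B)))
    {K : Type u} [Field K] (φ : B →+* K) (g : G) (hφ : ∀ b : B, φ (τB g b) = φ b) :
    g ∈ inertiaSubgroup ρB ((Spec.map (CommRingCat.ofHom φ)).base (closedPoint K)) := by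
  refine (mem_inertiaSubgroup_iff_comp_eq ρB (Spec.map (CommRingCat.ofHom φ)) g).mpr ?_
  rw [hρB, ← Spec.map_comp, ← CommRingCat.ofHom_comp]
  congr 2
  refine RingHom.ext fun b => ?_
  simp only [RingHom.coe_comp, RingHom.coe_coe, Function.comp_apply]
  have h := hφ (τB g⁻¹ b)
  rw [← RingEquiv.trans_apply, show (τB g⁻¹).trans (τB g) = τB (g * g⁻¹) by rw [map_mul]; rfl,
    mul_inv_cancel, map_one] at h
  exact h.symm

/-- **Residue-trivial `τ` on a local ring ⇒ every `g` is inert at the closed point of `Spec R`.** [folklore] -/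
theorem mem_inertiaSubgroup_closedPoint_of_hom_residueTrivial {R : Type u} [CommRing R] [IsLocalRing R]
    (τ : G →* (R ≃+* R)) (ρ : G →* Aut (Spec (CommRingCat.of R)))
    (hρ : ∀ g, (ρ g).hom = Spec.map (CommRingCat.ofHom ((τ g⁻¹ : R ≃+* R) : R →+* R)))
    (g : G) (hres : ∀ r : R, τ g r - r ∈ maximalIdeal R) :
    g ∈ inertiaSubgroup ρ (closedPoint R) := by
  have hφ : ∀ r : R, residue R (τ g r) = residue R r := fun r => by
    rw [← sub_eq_zero, ← map_sub, residue_eq_zero_iff]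
    exact hres r
  have key := mem_inertiaSubgroup_specMap_of_hom_invariant τ ρ hρ (residue R) g hφ
  have hpt : (Spec.map (CommRingCat.ofHom (residue R))).base (closedPoint (ResidueField R)) =
      closedPoint R := by
    apply PrimeSpectrum.ext
    change Ideal.comap (residue R) (maximalIdeal (ResidueField R)) = maximalIdeal R
    rw [show maximalIdeal (ResidueField R) = ⊥ from
      (isField_iff_maximalIdeal_eq).mp (Field.toIsField _), ← RingHom.ker_eq_comap_bot]
    exact ker_residue
  rwa [hpt] at key

end Summit.ResolutionOfSingularities.ResolutionOfSingularities.Theorems.WildQuotientResolution.KSGoingDown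

end
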